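import Mathlib
import Literature.Analysis.FluidPDE.AxisymmetricEuler
import Literature.Analysis.FluidPDE.EulerTimeScaling
import Literature.Analysis.FluidPDE.PineauVicolAngularMean
import Literature.Analysis.FluidPDE.PineauVicolRDSSTuning
import HarnessLib

/-!
# Line «spiral-closure» v2 (DSS-wall rung line on crux `TypeIQuarterGate.ScarEnvelopeTypeI`,
stmt-NavierStokesRegularity-23843) — obligations (S1) `AngleExtraction` and (S3) `SymSetMonoid`, landed

Author of the line and of these proofs: ns-idea-7 g4 (`Cruxes/ScarEnvelopeTypeI/Lines/spiral_closure.lean`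
v2, commit 6da3311cc495, sha256/16 `af35dd6c732afbc1`; critic of record idea-crit-7 g2, PASS-WITH-PRICE
2026-08-28T11:50:40Z). Landed by ns-in-wu-con g2 (KEY DIRECTOR-NS #216 (1)(a) / #218 (3)) with the
definitions `InvPair`, `symSet`, `AngleExtraction`, `SymSetMonoid` and the proof blocks
`angleExtraction_of … angleExtraction_holds`, `rotZ_rotZ_neg … symSetMonoid_holds` copied VERBATIM from the
v2 workfile (only changes: `(EuclideanSpace ℝ (Fin 3))` spelled out, this header).

* (S1) along any factors `c_n ↓ 1` and speeds `α_n`, ONE subsequence makes, for every `μ_j = 1 + 1/(j+1)`,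
  the rotation angles of the exponents `⌊log μ_j / log c_n⌋` (tree `PineauVicol2026.tendsto_pow_natFloor_log`)
  converge modulo `2π` — sequential compactness of `[0,2π]^ℕ` (Tychonoff + first countability);
* (S3) the forward symmetry set `symSet v` of a jointly continuous field is a closed additive monoid in
  `[0,∞) × ℝ` containing `(0,0)`, `(0,2π)`, stable under angle inversion at `σ = 0`.

No statement about Navier–Stokes is proved here; the line does NOT conclude stmt-23843.
-/

-- landing convention of this crux's line files (namespace of the line «spiral-closure»)
set_option linter.dupNamespace false

noncomputable section

namespace Summit.NavierStokesRegularity.NavierStokesRegularity.Cruxes.ScarEnvelopeTypeI.SpiralClosure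

open MeasureTheory Set Function Filter Topology Metric
open Literature.Analysis Literature.Analysis.FluidPDE

/-! ### The objects (verbatim from the line file) -/

/-- Invariance of a field `v` (on the past `t ≤ −1/4`, the tree's normalisation of Chae–Wolf limits) under
the scaling–rotation `(μ, R_θ)` about the `e₃`-axis: `v(t,x) = μ R_θ v(μ²t, μ R_{−θ} x)`.  For `θ = Θ μ` this
is verbatim the invariance output of `PineauVicol2026.exists_limit_rdss_tuned`. -/
def InvPair (v : ℝ → (EuclideanSpace ℝ (Fin 3)) → (EuclideanSpace ℝ (Fin 3))) (μ θ : ℝ) : Prop :=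
  ∀ t ≤ -(1 / 4 : ℝ), ∀ x : (EuclideanSpace ℝ (Fin 3)), v t x = μ • rotZ θ (v (μ ^ 2 * t) (μ • rotZ (-θ) x))

/-- The FORWARD SYMMETRY SET of `v` in logarithmic coordinates: `(σ, θ)` with `σ ≥ 0` and `v` invariant under
`(e^σ, R_θ)`.  (A closed additive monoid in `[0,∞) × ℝ` when `v` is continuous: `stub_symSetMonoid`.) -/
def symSet (v : ℝ → (EuclideanSpace ℝ (Fin 3)) → (EuclideanSpace ℝ (Fin 3))) : Set (ℝ × ℝ) :=
  {g | 0 ≤ g.1 ∧ InvPair v (Real.exp g.1) g.2}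

/-- (S1) ANGLE EXTRACTION (pure; Bolzano–Weierstrass + a diagonal subsequence): along any sequence of factors
`c_n ↓ 1` and speeds `α_n`, some subsequence admits, for every `μ_j = 1 + 1/(j+1)`, exponents `k_n` with
`c_n^{k_n} → μ_j` (tree `tendsto_pow_natFloor_log`) whose rotation angles converge modulo `2π`.  PROVED below. -/
def AngleExtraction : Prop :=
  ∀ (α c : ℕ → ℝ), (∀ n, 1 < c n) → Tendsto c atTop (𝓝 1) →
    ∃ φ : ℕ → ℕ, StrictMono φ ∧ ∃ Θ : ℕ → ℝ, ∀ j : ℕ, ∃ (k : ℕ → ℕ) (m : ℕ → ℤ),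
      Tendsto (fun n => c (φ n) ^ k n) atTop (𝓝 (1 + 1 / ((j : ℝ) + 1))) ∧
      Tendsto (fun n => α (φ n) * (2 * Real.log (c (φ n) ^ k n)) - 2 * Real.pi * m n) atTop
        (𝓝 (Θ j))

/-- (S3) The forward symmetry set of a continuous field is a CLOSED additive MONOID in `[0,∞) × ℝ`, stable
under angle inversion at `σ = 0`, containing `(0, 2π)` (rotations about the axis are `2π`-periodic, tree
`rotZ_two_pi`). -/
def SymSetMonoid : Prop :=
  ∀ v : ℝ → (EuclideanSpace ℝ (Fin 3)) → (EuclideanSpace ℝ (Fin 3)), Continuous (uncurry v) →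
    IsClosed (symSet v) ∧ ((0 : ℝ), (0 : ℝ)) ∈ symSet v ∧
      (∀ g ∈ symSet v, ∀ h ∈ symSet v, g + h ∈ symSet v) ∧
      (∀ θ : ℝ, ((0 : ℝ), θ) ∈ symSet v → ((0 : ℝ), -θ) ∈ symSet v) ∧
      ((0 : ℝ), 2 * Real.pi) ∈ symSet v

/-! ### (S1) proved (v2): angle extraction -/

/-- **PROVED (v2; was stub S1).** Bolzano–Weierstrass in the compact product `[0,2π]^ℕ` (Tychonoff +
first countability = the diagonal argument) on the angle residues of the exponents of
`PineauVicol2026.tendsto_pow_natFloor_log`. -/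
theorem angleExtraction_of : ∀ (α c : ℕ → ℝ), (∀ n, 1 < c n) → Tendsto c atTop (𝓝 1) →
    ∃ φ : ℕ → ℕ, StrictMono φ ∧ ∃ Θ : ℕ → ℝ, ∀ j : ℕ, ∃ (k : ℕ → ℕ) (m : ℕ → ℤ),
      Tendsto (fun n => c (φ n) ^ k n) atTop (𝓝 (1 + 1 / ((j : ℝ) + 1))) ∧
      Tendsto (fun n => α (φ n) * (2 * Real.log (c (φ n) ^ k n)) - 2 * Real.pi * m n) atTop
        (𝓝 (Θ j)) := by
  intro α c hc hclim
  have hμ1 : ∀ j : ℕ, (1 : ℝ) ≤ 1 + 1 / ((j : ℝ) + 1) := fun j =>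
    le_add_of_nonneg_right (by positivity)
  -- exponents, raw angles, their integer parts and residues
  set K : ℕ → ℕ → ℕ := fun j n => ⌊Real.log (1 + 1 / ((j : ℝ) + 1)) / Real.log (c n)⌋₊ with hK
  set A : ℕ → ℕ → ℝ := fun j n => α n * (2 * Real.log (c n ^ K j n)) with hA
  set m : ℕ → ℕ → ℤ := fun j n => ⌊A j n / (2 * Real.pi)⌋ with hm
  set r : ℕ → ℕ → ℝ := fun j n => A j n - 2 * Real.pi * (m j n) with hr
  have h2 : (0 : ℝ) < 2 * Real.pi := by positivity
  have hrI : ∀ j n, r j n ∈ Icc (0 : ℝ) (2 * Real.pi) := by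
    intro j n
    refine ⟨?_, ?_⟩
    · have h := Int.floor_le (A j n / (2 * Real.pi))
      rw [le_div_iff₀ h2] at h
      simp only [hr, hm]
      linarith
    · have h := Int.lt_floor_add_one (A j n / (2 * Real.pi))
      rw [div_lt_iff₀ h2] at h
      have e : ((⌊A j n / (2 * Real.pi)⌋ : ℝ) + 1) * (2 * Real.pi) =
          2 * Real.pi * ⌊A j n / (2 * Real.pi)⌋ + 2 * Real.pi := by ring
      simp only [hr, hm]
      linarith
  -- one sequence in the compact product `[0, 2π]^ℕ`
  set X : ℕ → (ℕ → ℝ) := fun n j => r j n with hX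
  have hcpt : IsCompact (Set.pi univ fun _ : ℕ => Icc (0 : ℝ) (2 * Real.pi)) :=
    isCompact_univ_pi fun _ => isCompact_Icc
  have hXmem : ∀ n, X n ∈ Set.pi univ fun _ : ℕ => Icc (0 : ℝ) (2 * Real.pi) :=
    fun n j _ => hrI j n
  obtain ⟨Θ, -, φ, hφ, hlim⟩ := hcpt.tendsto_subseq hXmem
  refine ⟨φ, hφ, Θ, fun j => ⟨fun n => K j (φ n), fun n => m j (φ n), ?_, ?_⟩⟩
  · exact (PineauVicol2026.tendsto_pow_natFloor_log hc hclim (hμ1 j)).comp hφ.tendsto_atTop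
  · exact tendsto_pi_nhds.1 hlim j

/-- (S1) in the registered form. -/
theorem angleExtraction_holds : AngleExtraction := angleExtraction_of

/-! ### (S3) proved (v2): the forward symmetry set is a closed monoid -/

/-- `R_θ R_{−θ} = id`. -/
theorem rotZ_rotZ_neg (θ : ℝ) (y : (EuclideanSpace ℝ (Fin 3))) : rotZ θ (rotZ (-θ) y) = y := by
  rw [← rotZ_add, add_neg_cancel, rotZ_zero]

/-- `R_{−θ} R_θ = id`. -/
theorem rotZ_neg_rotZ (θ : ℝ) (y : (EuclideanSpace ℝ (Fin 3))) : rotZ (-θ) (rotZ θ y) = y := by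
  rw [← rotZ_add, neg_add_cancel, rotZ_zero]

/-- Joint continuity of `(g, z) ↦` the conjugated value used in `InvPair`. -/
theorem continuous_invExpr {v : ℝ → (EuclideanSpace ℝ (Fin 3)) → (EuclideanSpace ℝ (Fin 3))} (hv : Continuous (uncurry v)) (t : ℝ) (x : (EuclideanSpace ℝ (Fin 3))) :
    Continuous fun g : ℝ × ℝ =>
      Real.exp g.1 • rotZ g.2 (v (Real.exp g.1 ^ 2 * t) (Real.exp g.1 • rotZ (-g.2) x)) := by
  have hexp : Continuous fun g : ℝ × ℝ => Real.exp g.1 := Real.continuous_exp.comp continuous_fst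
  have hrot : ∀ {f : ℝ × ℝ → ℝ} {w : ℝ × ℝ → (EuclideanSpace ℝ (Fin 3))}, Continuous f → Continuous w →
      Continuous fun g : ℝ × ℝ => rotZ (f g) (w g) := by
    intro f w hf hw
    have h := continuous_rotZ_uncurry'.comp (hf.prodMk hw)
    simpa only [Function.comp_def] using h
  have hin : Continuous fun g : ℝ × ℝ => Real.exp g.1 • rotZ (-g.2) x :=
    hexp.smul (hrot continuous_snd.neg continuous_const)
  have htime : Continuous fun g : ℝ × ℝ => Real.exp g.1 ^ 2 * t :=
    (hexp.pow 2).mul (continuous_const (y := t))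
  have hv' : Continuous fun g : ℝ × ℝ => v (Real.exp g.1 ^ 2 * t) (Real.exp g.1 • rotZ (-g.2) x) := by
    have h := hv.comp (htime.prodMk hin)
    simpa only [Function.comp_def, Function.uncurry_apply_pair] using h
  exact hexp.smul (hrot continuous_snd hv')

/-- `symSet v` is closed: level sets of the continuous maps `continuous_invExpr` and `0 ≤ σ` (v2, verbatim; docstring added at landing). -/
theorem symSet_isClosed {v : ℝ → (EuclideanSpace ℝ (Fin 3)) → (EuclideanSpace ℝ (Fin 3))} (hv : Continuous (uncurry v)) : IsClosed (symSet v) := by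
  have e : symSet v = {g : ℝ × ℝ | 0 ≤ g.1} ∩
      ⋂ (t : ℝ) (_ : t ≤ -(1 / 4 : ℝ)) (x : (EuclideanSpace ℝ (Fin 3))),
        {g : ℝ × ℝ | v t x =
          Real.exp g.1 • rotZ g.2 (v (Real.exp g.1 ^ 2 * t) (Real.exp g.1 • rotZ (-g.2) x))} := by
    ext g
    simp only [symSet, InvPair, mem_setOf_eq, mem_inter_iff, mem_iInter]
  rw [e]
  refine (isClosed_le continuous_const continuous_fst).inter ?_
  refine isClosed_iInter fun t => isClosed_iInter fun _ => isClosed_iInter fun x => ?_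
  exact isClosed_eq continuous_const (continuous_invExpr hv t x)

/-- `(0,0) ∈ symSet v`: the identity `(1, R_0)` (v2, verbatim; docstring added at landing). -/
theorem symSet_zero_mem (v : ℝ → (EuclideanSpace ℝ (Fin 3)) → (EuclideanSpace ℝ (Fin 3))) : ((0 : ℝ), (0 : ℝ)) ∈ symSet v := by
  refine ⟨le_rfl, fun t _ x => ?_⟩
  simp [rotZ_zero]

/-- `symSet v` is additively closed: compose the two invariances, the inner one at the earlier time `e^{2σ₁}t ≤ t ≤ −1/4` (v2, verbatim; docstring added at landing). -/
theorem symSet_add_mem {v : ℝ → (EuclideanSpace ℝ (Fin 3)) → (EuclideanSpace ℝ (Fin 3))} {g h : ℝ × ℝ} (hg : g ∈ symSet v) (hh : h ∈ symSet v) :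
    g + h ∈ symSet v := by
  obtain ⟨hg0, hgI⟩ := hg
  obtain ⟨hh0, hhI⟩ := hh
  refine ⟨by simp only [Prod.fst_add]; positivity, fun t ht x => ?_⟩
  set μ := Real.exp g.1 with hμ
  set μ' := Real.exp h.1 with hμ'
  have hμ1 : 1 ≤ μ := by rw [hμ]; exact Real.one_le_exp hg0
  have ht' : μ ^ 2 * t ≤ -(1 / 4 : ℝ) := by
    have h1 : 1 ≤ μ ^ 2 := one_le_pow₀ hμ1
    nlinarith
  rw [hgI t ht x, hhI _ ht' _]
  simp only [Prod.fst_add, Prod.snd_add, Real.exp_add, ← hμ, ← hμ']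
  -- normalise: scalars through rotations, compose rotations
  rw [show μ' ^ 2 * (μ ^ 2 * t) = (μ * μ') ^ 2 * t by ring,
    show μ' • rotZ (-h.2) (μ • rotZ (-g.2) x) = (μ * μ') • rotZ (-(g.2 + h.2)) x by
      rw [rotZ_smul, smul_smul, ← rotZ_add, mul_comm μ' μ, neg_add_rev],
    rotZ_smul, smul_smul, ← rotZ_add]

/-- Angle inversion at `σ = 0`: substitute `x ↦ R_θ x` (v2, verbatim; docstring added at landing). -/
theorem symSet_neg_mem {v : ℝ → (EuclideanSpace ℝ (Fin 3)) → (EuclideanSpace ℝ (Fin 3))} {θ : ℝ} (h : ((0 : ℝ), θ) ∈ symSet v) :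
    ((0 : ℝ), -θ) ∈ symSet v := by
  obtain ⟨-, hI⟩ := h
  refine ⟨le_rfl, fun t ht x => ?_⟩
  have key := hI t ht (rotZ θ x)
  simp only [Real.exp_zero, one_pow, one_mul, one_smul, rotZ_neg_rotZ] at key
  simp only [Real.exp_zero, one_pow, one_mul, one_smul, neg_neg]
  rw [key, rotZ_neg_rotZ]

/-- `(0,2π) ∈ symSet v`: one full turn is the identity (v2, verbatim; docstring added at landing). -/
theorem symSet_two_pi_mem (v : ℝ → (EuclideanSpace ℝ (Fin 3)) → (EuclideanSpace ℝ (Fin 3))) : ((0 : ℝ), 2 * Real.pi) ∈ symSet v := by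
  refine ⟨le_rfl, fun t _ x => ?_⟩
  simp only [Real.exp_zero, one_pow, one_mul, one_smul, rotZ_two_pi, rotZ_neg_two_pi]

/-- **PROVED (v2; was stub S3).** -/
theorem symSetMonoid_of : ∀ v : ℝ → (EuclideanSpace ℝ (Fin 3)) → (EuclideanSpace ℝ (Fin 3)), Continuous (uncurry v) →
    IsClosed (symSet v) ∧ ((0 : ℝ), (0 : ℝ)) ∈ symSet v ∧
      (∀ g ∈ symSet v, ∀ h ∈ symSet v, g + h ∈ symSet v) ∧
      (∀ θ : ℝ, ((0 : ℝ), θ) ∈ symSet v → ((0 : ℝ), -θ) ∈ symSet v) ∧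
      ((0 : ℝ), 2 * Real.pi) ∈ symSet v :=
  fun v hv => ⟨symSet_isClosed hv, symSet_zero_mem v, fun _ hg _ hh => symSet_add_mem hg hh,
    fun _ h => symSet_neg_mem h, symSet_two_pi_mem v⟩

/-- (S3) in the registered form. -/
theorem symSetMonoid_holds : SymSetMonoid := symSetMonoid_of

end Summit.NavierStokesRegularity.NavierStokesRegularity.Cruxes.ScarEnvelopeTypeI.SpiralClosure

end
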